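import Summits.RiemannHypothesis.RiemannHypothesis.Theorems.WeilFormatCArchRemainder
import Summits.RiemannHypothesis.RiemannHypothesis.Theorems.WeilFormatCHilbertPartPSD
import Summits.RiemannHypothesis.RiemannHypothesis.Theorems.WeilFormatCHilbertPartLogBound
import Summits.RiemannHypothesis.RiemannHypothesis.Theorems.WeilFormatCOffDiagHSBound
import HarnessLib

/-!
# Format C: the ARCHIMEDEAN sector kernels are `⪰ diag(e^±)` on the far modes `M₁ < n ≤ N` — L-C3a, arch part

Route context: Fourier–Galerkin / Schur-complement certificates of Weil positivity on a window ("format C";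
cell memo `run/shared/lean/pub/rh-explicit/rh-explicit-weil-10/FORMATC-DESIGN.md` §4.3 / §4.10 / §9.1; supporting
stmt-RiemannHypothesis-0098; seat rh-explicit-weil-10).  Assembly of the archimedean part of the far-coercivity lemma on the
ACTUAL kernel `Yoshida1992.archCoeff a`, for every finite far truncation `s = Ioc M₁ N` (`1 ≤ M₁`, `0 < a`;
`E = weilArchDensity (2a)`, `c_R = a(1+E)/π²`, `ω_n = πn/a`; M-units = weil-2 SectorSplit kernels):

* `abs_sum_sum_mul_le_sqrt_mul` — Hilbert–Schmidt bounds the form: `|yᵀKy| ≤ √(ΣΣK²)·Σy²` (any finite index set);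
* `evenArch_far_ge_diag` — **`Σ_{n∈s} e⁺(n) y_n² ≤ Σ_{n,m∈s} y_n A⁺(n,m) y_m`**,
  `e⁺(n) = ½(Re ψ(¼+iω_n/2) − log π) − a(1+E)/(π²n²) − 1/(8n) − c_R√(8/M₁)`
  (diagonal `evenArch_diag_ge` + Hilbert main part `⪰ 0` (`hilbertPart_nonneg`) minus its diagonal `1/(8n)` + remainder in
  Hilbert–Schmidt norm `≤ c_R√(8/M₁)` via `sum_sum_sq_le_of_offDiag_bound`);
* `oddArch_far_ge_diag` — **`Σ_{n∈s} e⁻(n) y_n² ≤ Σ_{n,m∈s} y_n A⁻(n,m) y_m`**,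
  `e⁻(n) = ½(Re ψ(¼+iω_n/2) − log π) − 1/(8n) − a(1+E)/(π²n²) − ¼·log((n+M₁)/M₁) − c_R√(8/M₁)`
  (the odd Hilbert main part `−(−1)^{n+m}/(4(n+m))` costs `¼ log((n+M₁)/M₁)` by the log-weight Schur test
  `abs_hilbertPart_le_log`, FORMATC-DESIGN §8.7); `oddArch_far_ge_diag_atan` — the same with the bounded arctan weight
  `½(π/2 − arctan(√M₁/√n))` (`abs_hilbertPart_le`, the DATA pipeline's default).

With `primeCoeff_form_ge` (PRIME), `polarCoeff_form_{nonneg_of_even,ge_of_odd}` (POLAR) and the transfers of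
`WeilFormatCSectorTransfer.lean` these give hypothesis `hfar` of `sum_range_mul_mul_nonneg_of_certificate` for
`G = gramCoeff a` with the explicit far diagonal `d̂^± = e^± − A_op⁺/2 [− s²a/(π²M₁) odd]` (sequel).  Standard axioms;
no definitions; no RH claim.
-/

set_option autoImplicit false
-- `Summit.RiemannHypothesis.RiemannHypothesis.…` is the layout-mandated namespace (summit = problem name).
set_option linter.dupNamespace false

noncomputable section

open Complex Finset
open scoped Real BigOperators

namespace Summit.RiemannHypothesis.RiemannHypothesis.Theorems.WeilFormatC

open Literature.NumberTheory.LFunctions Literature.NumberTheory.LFunctions.Yoshida1992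
open Literature.Analysis.SpecialFunctions

/-! ## Hilbert–Schmidt bound for a real quadratic form on a finite index set -/

/-- `|Σ_{n,m∈s} y_n K(n,m) y_m| ≤ √(Σ_{n,m∈s} K(n,m)²) · Σ_{n∈s} y_n²` (Cauchy–Schwarz twice). -/
theorem abs_sum_sum_mul_le_sqrt_mul {ι : Type*} (s : Finset ι) (K : ι → ι → ℝ) (y : ι → ℝ) :
    |∑ n ∈ s, ∑ m ∈ s, y n * K n m * y m|
      ≤ Real.sqrt (∑ n ∈ s, ∑ m ∈ s, K n m ^ 2) * ∑ n ∈ s, y n ^ 2 := by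
  set Y := ∑ n ∈ s, y n ^ 2 with hY
  set H := ∑ n ∈ s, ∑ m ∈ s, K n m ^ 2 with hH
  have hY0 : 0 ≤ Y := Finset.sum_nonneg fun n _ ↦ sq_nonneg _
  have e1 : ∑ n ∈ s, ∑ m ∈ s, y n * K n m * y m = ∑ n ∈ s, y n * ∑ m ∈ s, K n m * y m := by
    refine Finset.sum_congr rfl fun n _ ↦ ?_
    rw [Finset.mul_sum]
    exact Finset.sum_congr rfl fun m _ ↦ by ring
  have h1 : (∑ n ∈ s, ∑ m ∈ s, y n * K n m * y m) ^ 2 ≤ Y * ∑ n ∈ s, (∑ m ∈ s, K n m * y m) ^ 2 := by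
    rw [e1]; exact Finset.sum_mul_sq_le_sq_mul_sq s y _
  have h2 : ∑ n ∈ s, (∑ m ∈ s, K n m * y m) ^ 2 ≤ H * Y := by
    rw [hH, Finset.sum_mul]
    exact Finset.sum_le_sum fun n _ ↦ Finset.sum_mul_sq_le_sq_mul_sq s (K n) y
  have h3 : (∑ n ∈ s, ∑ m ∈ s, y n * K n m * y m) ^ 2 ≤ H * Y ^ 2 := by
    calc (∑ n ∈ s, ∑ m ∈ s, y n * K n m * y m) ^ 2 ≤ Y * (H * Y) := h1.trans (mul_le_mul_of_nonneg_left h2 hY0)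
      _ = H * Y ^ 2 := by ring
  calc |∑ n ∈ s, ∑ m ∈ s, y n * K n m * y m|
      = Real.sqrt ((∑ n ∈ s, ∑ m ∈ s, y n * K n m * y m) ^ 2) := (Real.sqrt_sq_eq_abs _).symm
    _ ≤ Real.sqrt (H * Y ^ 2) := Real.sqrt_le_sqrt h3
    _ = Real.sqrt H * Y := by rw [Real.sqrt_mul' _ (sq_nonneg Y), Real.sqrt_sq hY0]

/-- `(−1)^{n+m}` (integer exponent, natural indices) is `(−1)^n·(−1)^m`. -/
theorem neg_one_zpow_natCast_add (n m : ℕ) : (-1 : ℝ) ^ ((n : ℤ) + m) = (-1) ^ n * (-1) ^ m := by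
  rw [show ((n : ℤ) + m) = ((n + m : ℕ) : ℤ) by push_cast; ring, zpow_natCast, pow_add]

/-- `√(8c²/M₁) = c·√(8/M₁)` for `c ≥ 0`. -/
theorem sqrt_eight_mul_sq_div {c M : ℝ} (hc : 0 ≤ c) : Real.sqrt (8 * c ^ 2 / M) = c * Real.sqrt (8 / M) := by
  rw [show 8 * c ^ 2 / M = c ^ 2 * (8 / M) by ring, Real.sqrt_mul (sq_nonneg c), Real.sqrt_sq hc]

section Far

variable {a : ℝ}

/-- **Even archimedean far bound.**  For `a > 0`, `1 ≤ M₁` and every real `y` on `s = Ioc M₁ N`: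
`Σ_{n∈s} e⁺(n) y_n² ≤ Σ_{n,m∈s} y_n A⁺(n,m) y_m` with `A⁺(n,m) = (archCoeff a n m + archCoeff a n (−m))/2` and
`e⁺(n) = ½(Re ψ(¼+iω_n/2) − log π) − a(1+E)/(π²n²) − 1/(8n) − (a(1+E)/π²)·√(8/M₁)`. -/
theorem evenArch_far_ge_diag (ha : 0 < a) {M₁ : ℕ} (hM : 1 ≤ M₁) (N : ℕ) (y : ℕ → ℝ) :
    ∑ n ∈ Finset.Ioc M₁ N,
        ((reDigammaQuarter (freq a n) - Real.log π) / 2 - a * (1 + weilArchDensity (2 * a)) / (π ^ 2 * n ^ 2)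
          - 1 / (8 * n) - a * (1 + weilArchDensity (2 * a)) / π ^ 2 * Real.sqrt (8 / M₁)) * y n ^ 2
      ≤ ∑ n ∈ Finset.Ioc M₁ N, ∑ m ∈ Finset.Ioc M₁ N,
          y n * ((archCoeff a n m + archCoeff a n (-(m : ℤ))) / 2) * y m := by
  set s := Finset.Ioc M₁ N with hs
  set E := weilArchDensity (2 * a) with hE
  set c : ℝ := a * (1 + E) / π ^ 2 with hc
  have hE0 : 0 < E := weilArchDensity_pos (by positivity)
  have hc0 : 0 ≤ c := by positivity
  have hs1 : ∀ n ∈ s, 1 ≤ n := fun n hn ↦ le_trans hM (Finset.mem_Ioc.mp hn).1.le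
  -- the three pieces
  set A : ℕ → ℕ → ℝ := fun n m ↦ (archCoeff a n m + archCoeff a n (-(m : ℤ))) / 2 with hA
  set H : ℕ → ℕ → ℝ := fun n m ↦ (-1 : ℝ) ^ ((n : ℤ) + m) / (4 * ((n : ℝ) + m)) with hH
  set R : ℕ → ℕ → ℝ := fun n m ↦ if n = m then 0 else A n m - H n m with hR
  have hsplit : ∀ n ∈ s, ∀ m ∈ s,
      y n * A n m * y m = (if n = m then (A n n - 1 / (8 * n)) * y n ^ 2 else 0) + y n * H n m * y m + y n * R n m * y m := by
    intro n _ m _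
    by_cases hnm : n = m
    · subst hnm
      simp only [hR, if_true, hH]
      rw [show ((n : ℤ) + n) = ((n + n : ℕ) : ℤ) by push_cast; ring, zpow_natCast,
        Even.neg_one_pow ⟨n, rfl⟩]
      ring
    · simp only [hR, if_neg hnm]
      ring
  have hform : ∑ n ∈ s, ∑ m ∈ s, y n * A n m * y m
      = ∑ n ∈ s, (A n n - 1 / (8 * n)) * y n ^ 2 + ∑ n ∈ s, ∑ m ∈ s, y n * H n m * y m
        + ∑ n ∈ s, ∑ m ∈ s, y n * R n m * y m := by
    rw [← Finset.sum_add_distrib, ← Finset.sum_add_distrib]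
    refine Finset.sum_congr rfl fun n hn ↦ ?_
    rw [Finset.sum_congr rfl fun m hm ↦ hsplit n hn m hm, Finset.sum_add_distrib, Finset.sum_add_distrib,
      Finset.sum_ite_eq s n, if_pos hn]
  -- (i) diagonal
  have hdiag : ∑ n ∈ s, ((reDigammaQuarter (freq a n) - Real.log π) / 2 - a * (1 + E) / (π ^ 2 * n ^ 2)
      - 1 / (8 * n)) * y n ^ 2 ≤ ∑ n ∈ s, (A n n - 1 / (8 * n)) * y n ^ 2 := by
    refine Finset.sum_le_sum fun n hn ↦ mul_le_mul_of_nonneg_right ?_ (sq_nonneg _)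
    have h := evenArch_diag_ge ha (hs1 n hn)
    simp only [hA]
    linarith
  -- (ii) Hilbert main part ⪰ 0
  have hHil : 0 ≤ ∑ n ∈ s, ∑ m ∈ s, y n * H n m * y m := by
    have h := hilbertPart_nonneg s hs1 (fun n ↦ (-1 : ℝ) ^ n * y n)
    have e : ∑ n ∈ s, ∑ m ∈ s, y n * H n m * y m
        = (1 / 4) * ∑ n ∈ s, ∑ m ∈ s, ((-1 : ℝ) ^ n * y n) * (1 / ((n : ℝ) + m)) * ((-1 : ℝ) ^ m * y m) := by
      rw [Finset.mul_sum]
      refine Finset.sum_congr rfl fun n hn ↦ ?_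
      rw [Finset.mul_sum]
      refine Finset.sum_congr rfl fun m _ ↦ ?_
      simp only [hH, neg_one_zpow_natCast_add]
      have hpos : (0 : ℝ) < (n : ℝ) + m := by
        have h1 : (1 : ℝ) ≤ n := by exact_mod_cast hs1 n hn
        have h2 : (0 : ℝ) ≤ m := by positivity
        linarith
      field_simp
    rw [e]; positivity
  -- (iii) remainder in Hilbert–Schmidt norm
  have hRdiag : ∀ n, R n n = 0 := fun n ↦ by simp [hR]
  have hRoff : ∀ n ∈ s, ∀ m ∈ s, n ≠ m → |R n m| ≤ c / (((min n m : ℕ) : ℝ) * |(n : ℝ) - m|) := by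
    intro n hn m hm hnm
    simp only [hR, if_neg hnm, hA, hH]
    exact abs_evenArch_offDiag_sub_hilbert_le ha (hs1 n hn) (hs1 m hm) hnm
  have hHS := sum_sum_sq_le_of_offDiag_bound (N := N) hM R hc0 hRdiag hRoff
  have hRform : |∑ n ∈ s, ∑ m ∈ s, y n * R n m * y m| ≤ c * Real.sqrt (8 / M₁) * ∑ n ∈ s, y n ^ 2 := by
    refine (abs_sum_sum_mul_le_sqrt_mul s R y).trans ?_
    refine mul_le_mul_of_nonneg_right ?_ (Finset.sum_nonneg fun n _ ↦ sq_nonneg _)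
    rw [← sqrt_eight_mul_sq_div hc0]
    exact Real.sqrt_le_sqrt hHS
  have hRge : -(c * Real.sqrt (8 / M₁) * ∑ n ∈ s, y n ^ 2) ≤ ∑ n ∈ s, ∑ m ∈ s, y n * R n m * y m := by
    have := neg_abs_le (∑ n ∈ s, ∑ m ∈ s, y n * R n m * y m); linarith
  -- assemble
  have hlhs : ∑ n ∈ s, ((reDigammaQuarter (freq a n) - Real.log π) / 2 - a * (1 + E) / (π ^ 2 * n ^ 2)
      - 1 / (8 * n) - a * (1 + E) / π ^ 2 * Real.sqrt (8 / M₁)) * y n ^ 2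
      = ∑ n ∈ s, ((reDigammaQuarter (freq a n) - Real.log π) / 2 - a * (1 + E) / (π ^ 2 * n ^ 2)
          - 1 / (8 * n)) * y n ^ 2 - c * Real.sqrt (8 / M₁) * ∑ n ∈ s, y n ^ 2 := by
    rw [Finset.mul_sum, ← Finset.sum_sub_distrib]
    refine Finset.sum_congr rfl fun n _ ↦ by ring
  rw [hlhs, hform]
  linarith

/-- **Odd archimedean far bound.**  For `a > 0`, `1 ≤ M₁` and every real `y` on `s = Ioc M₁ N`:
`Σ_{n∈s} e⁻(n) y_n² ≤ Σ_{n,m∈s} y_n A⁻(n,m) y_m` with `A⁻(n,m) = (archCoeff a n m − archCoeff a n (−m))/2` and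
`e⁻(n) = ½(Re ψ(¼+iω_n/2) − log π) − 1/(8n) − a(1+E)/(π²n²) − ¼·log((n+M₁)/M₁) − (a(1+E)/π²)·√(8/M₁)`. -/
theorem oddArch_far_ge_diag (ha : 0 < a) {M₁ : ℕ} (hM : 1 ≤ M₁) (N : ℕ) (y : ℕ → ℝ) :
    ∑ n ∈ Finset.Ioc M₁ N,
        ((reDigammaQuarter (freq a n) - Real.log π) / 2 - 1 / (8 * n)
          - a * (1 + weilArchDensity (2 * a)) / (π ^ 2 * n ^ 2) - Real.log (((n : ℝ) + M₁) / M₁) / 4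
          - a * (1 + weilArchDensity (2 * a)) / π ^ 2 * Real.sqrt (8 / M₁)) * y n ^ 2
      ≤ ∑ n ∈ Finset.Ioc M₁ N, ∑ m ∈ Finset.Ioc M₁ N,
          y n * ((archCoeff a n m - archCoeff a n (-(m : ℤ))) / 2) * y m := by
  set s := Finset.Ioc M₁ N with hs
  set E := weilArchDensity (2 * a) with hE
  set c : ℝ := a * (1 + E) / π ^ 2 with hc
  have hE0 : 0 < E := weilArchDensity_pos (by positivity)
  have hc0 : 0 ≤ c := by positivity
  have hs1 : ∀ n ∈ s, 1 ≤ n := fun n hn ↦ le_trans hM (Finset.mem_Ioc.mp hn).1.le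
  -- empty truncation
  rcases lt_or_ge N M₁ with hNM | hMN
  · have hse : s = ∅ := Finset.Ioc_eq_empty (by omega)
    rw [hse]; simp
  set A : ℕ → ℕ → ℝ := fun n m ↦ (archCoeff a n m - archCoeff a n (-(m : ℤ))) / 2 with hA
  set H : ℕ → ℕ → ℝ := fun n m ↦ (-1 : ℝ) ^ ((n : ℤ) + m) / (4 * ((n : ℝ) + m)) with hH
  set R : ℕ → ℕ → ℝ := fun n m ↦ if n = m then 0 else A n m + H n m with hR
  have hsplit : ∀ n ∈ s, ∀ m ∈ s,
      y n * A n m * y m = (if n = m then (A n n + 1 / (8 * n)) * y n ^ 2 else 0) - y n * H n m * y m + y n * R n m * y m := by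
    intro n _ m _
    by_cases hnm : n = m
    · subst hnm
      simp only [hR, if_true, hH]
      rw [show ((n : ℤ) + n) = ((n + n : ℕ) : ℤ) by push_cast; ring, zpow_natCast,
        Even.neg_one_pow ⟨n, rfl⟩]
      ring
    · simp only [hR, if_neg hnm]
      ring
  have hform : ∑ n ∈ s, ∑ m ∈ s, y n * A n m * y m
      = ∑ n ∈ s, (A n n + 1 / (8 * n)) * y n ^ 2 - ∑ n ∈ s, ∑ m ∈ s, y n * H n m * y m
        + ∑ n ∈ s, ∑ m ∈ s, y n * R n m * y m := by
    rw [← Finset.sum_sub_distrib, ← Finset.sum_add_distrib]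
    refine Finset.sum_congr rfl fun n hn ↦ ?_
    rw [Finset.sum_congr rfl fun m hm ↦ hsplit n hn m hm, Finset.sum_add_distrib, Finset.sum_sub_distrib,
      Finset.sum_ite_eq s n, if_pos hn]
  -- (i) diagonal
  have hdiag : ∑ n ∈ s, ((reDigammaQuarter (freq a n) - Real.log π) / 2 - 1 / (8 * n)
      - a * (1 + E) / (π ^ 2 * n ^ 2)) * y n ^ 2 ≤ ∑ n ∈ s, (A n n + 1 / (8 * n)) * y n ^ 2 := by
    refine Finset.sum_le_sum fun n hn ↦ mul_le_mul_of_nonneg_right ?_ (sq_nonneg _)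
    have h := oddArch_diag_ge ha (hs1 n hn)
    have hn0 : (0 : ℝ) < n := by exact_mod_cast hs1 n hn
    have e : 1 / (4 * (n : ℝ)) = 1 / (8 * n) + 1 / (8 * n) := by field_simp; norm_num
    simp only [hA]
    linarith
  -- (ii) Hilbert main part, log-weight Schur test
  have hHil : ∑ n ∈ s, ∑ m ∈ s, y n * H n m * y m ≤ ∑ n ∈ s, Real.log (((n : ℝ) + M₁) / M₁) / 4 * y n ^ 2 := by
    have h := abs_hilbertPart_le_log hM hMN (fun n ↦ (-1 : ℝ) ^ n * y n)
    have e : ∑ n ∈ s, ∑ m ∈ s, y n * H n m * y m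
        = (1 / 4) * ∑ n ∈ s, ∑ m ∈ s, ((-1 : ℝ) ^ n * y n) * (1 / ((n : ℝ) + m)) * ((-1 : ℝ) ^ m * y m) := by
      rw [Finset.mul_sum]
      refine Finset.sum_congr rfl fun n hn ↦ ?_
      rw [Finset.mul_sum]
      refine Finset.sum_congr rfl fun m _ ↦ ?_
      simp only [hH, neg_one_zpow_natCast_add]
      have hpos : (0 : ℝ) < (n : ℝ) + m := by
        have h1 : (1 : ℝ) ≤ n := by exact_mod_cast hs1 n hn
        have h2 : (0 : ℝ) ≤ m := by positivity
        linarith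
      field_simp
    have e2 : ∑ n ∈ s, Real.log (((n : ℝ) + M₁) / M₁) / 4 * y n ^ 2
        = (1 / 4) * ∑ n ∈ s, Real.log (((n : ℝ) + M₁) / M₁) * ((-1 : ℝ) ^ n * y n) ^ 2 := by
      rw [Finset.mul_sum]
      refine Finset.sum_congr rfl fun n _ ↦ ?_
      have hsq : ((-1 : ℝ) ^ n * y n) ^ 2 = y n ^ 2 := by
        rw [mul_pow, ← pow_mul, Nat.mul_comm, pow_mul, neg_one_sq, one_pow, one_mul]
      rw [hsq]
      ring
    rw [e, e2]
    have := le_abs_self (∑ n ∈ s, ∑ m ∈ s, ((-1 : ℝ) ^ n * y n) * (1 / ((n : ℝ) + m)) * ((-1 : ℝ) ^ m * y m))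
    linarith
  -- (iii) remainder
  have hRdiag : ∀ n, R n n = 0 := fun n ↦ by simp [hR]
  have hRoff : ∀ n ∈ s, ∀ m ∈ s, n ≠ m → |R n m| ≤ c / (((min n m : ℕ) : ℝ) * |(n : ℝ) - m|) := by
    intro n hn m hm hnm
    simp only [hR, if_neg hnm, hA, hH]
    exact abs_oddArch_offDiag_add_hilbert_le ha (hs1 n hn) (hs1 m hm) hnm
  have hHS := sum_sum_sq_le_of_offDiag_bound (N := N) hM R hc0 hRdiag hRoff
  have hRform : |∑ n ∈ s, ∑ m ∈ s, y n * R n m * y m| ≤ c * Real.sqrt (8 / M₁) * ∑ n ∈ s, y n ^ 2 := by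
    refine (abs_sum_sum_mul_le_sqrt_mul s R y).trans ?_
    refine mul_le_mul_of_nonneg_right ?_ (Finset.sum_nonneg fun n _ ↦ sq_nonneg _)
    rw [← sqrt_eight_mul_sq_div hc0]
    exact Real.sqrt_le_sqrt hHS
  have hRge : -(c * Real.sqrt (8 / M₁) * ∑ n ∈ s, y n ^ 2) ≤ ∑ n ∈ s, ∑ m ∈ s, y n * R n m * y m := by
    have := neg_abs_le (∑ n ∈ s, ∑ m ∈ s, y n * R n m * y m); linarith
  -- assemble
  have hlhs : ∑ n ∈ s, ((reDigammaQuarter (freq a n) - Real.log π) / 2 - 1 / (8 * n)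
      - a * (1 + E) / (π ^ 2 * n ^ 2) - Real.log (((n : ℝ) + M₁) / M₁) / 4
      - a * (1 + E) / π ^ 2 * Real.sqrt (8 / M₁)) * y n ^ 2
      = ∑ n ∈ s, ((reDigammaQuarter (freq a n) - Real.log π) / 2 - 1 / (8 * n)
          - a * (1 + E) / (π ^ 2 * n ^ 2)) * y n ^ 2
        - ∑ n ∈ s, Real.log (((n : ℝ) + M₁) / M₁) / 4 * y n ^ 2
        - c * Real.sqrt (8 / M₁) * ∑ n ∈ s, y n ^ 2 := by
    rw [Finset.mul_sum, ← Finset.sum_sub_distrib, ← Finset.sum_sub_distrib]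
    refine Finset.sum_congr rfl fun n _ ↦ by ring
  rw [hlhs, hform]
  linarith

/-- **Odd archimedean far bound, arctan weights** (FORMATC-DESIGN §4.3/§4.10, the `JOB_HILBERT=atan` far bound of the
DATA certificates t-09-C … t-1039-1000-C): as `oddArch_far_ge_diag` with the BOUNDED Hilbert cost
`½(π/2 − arctan(√M₁/√n)) ≤ π/4` (`abs_hilbertPart_le`) in place of `¼ log((n+M₁)/M₁)`.  For `a > 0`, `1 ≤ M₁` and every real `y` on `s = Ioc M₁ N`:
`Σ_{n∈s} e⁻(n) y_n² ≤ Σ_{n,m∈s} y_n A⁻(n,m) y_m` with `A⁻(n,m) = (archCoeff a n m − archCoeff a n (−m))/2` and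
`e⁻(n) = ½(Re ψ(¼+iω_n/2) − log π) − 1/(8n) − a(1+E)/(π²n²) − ½(π/2 − arctan(√M₁/√n)) − (a(1+E)/π²)·√(8/M₁)`. -/
theorem oddArch_far_ge_diag_atan (ha : 0 < a) {M₁ : ℕ} (hM : 1 ≤ M₁) (N : ℕ) (y : ℕ → ℝ) :
    ∑ n ∈ Finset.Ioc M₁ N,
        ((reDigammaQuarter (freq a n) - Real.log π) / 2 - 1 / (8 * n)
          - a * (1 + weilArchDensity (2 * a)) / (π ^ 2 * n ^ 2) - (π / 2 - Real.arctan (Real.sqrt M₁ / Real.sqrt n)) / 2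
          - a * (1 + weilArchDensity (2 * a)) / π ^ 2 * Real.sqrt (8 / M₁)) * y n ^ 2
      ≤ ∑ n ∈ Finset.Ioc M₁ N, ∑ m ∈ Finset.Ioc M₁ N,
          y n * ((archCoeff a n m - archCoeff a n (-(m : ℤ))) / 2) * y m := by
  set s := Finset.Ioc M₁ N with hs
  set E := weilArchDensity (2 * a) with hE
  set c : ℝ := a * (1 + E) / π ^ 2 with hc
  have hE0 : 0 < E := weilArchDensity_pos (by positivity)
  have hc0 : 0 ≤ c := by positivity
  have hs1 : ∀ n ∈ s, 1 ≤ n := fun n hn ↦ le_trans hM (Finset.mem_Ioc.mp hn).1.le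
  -- empty truncation
  rcases lt_or_ge N M₁ with hNM | hMN
  · have hse : s = ∅ := Finset.Ioc_eq_empty (by omega)
    rw [hse]; simp
  set A : ℕ → ℕ → ℝ := fun n m ↦ (archCoeff a n m - archCoeff a n (-(m : ℤ))) / 2 with hA
  set H : ℕ → ℕ → ℝ := fun n m ↦ (-1 : ℝ) ^ ((n : ℤ) + m) / (4 * ((n : ℝ) + m)) with hH
  set R : ℕ → ℕ → ℝ := fun n m ↦ if n = m then 0 else A n m + H n m with hR
  have hsplit : ∀ n ∈ s, ∀ m ∈ s,
      y n * A n m * y m = (if n = m then (A n n + 1 / (8 * n)) * y n ^ 2 else 0) - y n * H n m * y m + y n * R n m * y m := by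
    intro n _ m _
    by_cases hnm : n = m
    · subst hnm
      simp only [hR, if_true, hH]
      rw [show ((n : ℤ) + n) = ((n + n : ℕ) : ℤ) by push_cast; ring, zpow_natCast,
        Even.neg_one_pow ⟨n, rfl⟩]
      ring
    · simp only [hR, if_neg hnm]
      ring
  have hform : ∑ n ∈ s, ∑ m ∈ s, y n * A n m * y m
      = ∑ n ∈ s, (A n n + 1 / (8 * n)) * y n ^ 2 - ∑ n ∈ s, ∑ m ∈ s, y n * H n m * y m
        + ∑ n ∈ s, ∑ m ∈ s, y n * R n m * y m := by
    rw [← Finset.sum_sub_distrib, ← Finset.sum_add_distrib]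
    refine Finset.sum_congr rfl fun n hn ↦ ?_
    rw [Finset.sum_congr rfl fun m hm ↦ hsplit n hn m hm, Finset.sum_add_distrib, Finset.sum_sub_distrib,
      Finset.sum_ite_eq s n, if_pos hn]
  -- (i) diagonal
  have hdiag : ∑ n ∈ s, ((reDigammaQuarter (freq a n) - Real.log π) / 2 - 1 / (8 * n)
      - a * (1 + E) / (π ^ 2 * n ^ 2)) * y n ^ 2 ≤ ∑ n ∈ s, (A n n + 1 / (8 * n)) * y n ^ 2 := by
    refine Finset.sum_le_sum fun n hn ↦ mul_le_mul_of_nonneg_right ?_ (sq_nonneg _)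
    have h := oddArch_diag_ge ha (hs1 n hn)
    have hn0 : (0 : ℝ) < n := by exact_mod_cast hs1 n hn
    have e : 1 / (4 * (n : ℝ)) = 1 / (8 * n) + 1 / (8 * n) := by field_simp; norm_num
    simp only [hA]
    linarith
  -- (ii) Hilbert main part, log-weight Schur test
  have hHil : ∑ n ∈ s, ∑ m ∈ s, y n * H n m * y m ≤ ∑ n ∈ s, (π / 2 - Real.arctan (Real.sqrt M₁ / Real.sqrt n)) / 2 * y n ^ 2 := by
    have h := abs_hilbertPart_le hM hMN (fun n ↦ (-1 : ℝ) ^ n * y n)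
    have e : ∑ n ∈ s, ∑ m ∈ s, y n * H n m * y m
        = (1 / 4) * ∑ n ∈ s, ∑ m ∈ s, ((-1 : ℝ) ^ n * y n) * (1 / ((n : ℝ) + m)) * ((-1 : ℝ) ^ m * y m) := by
      rw [Finset.mul_sum]
      refine Finset.sum_congr rfl fun n hn ↦ ?_
      rw [Finset.mul_sum]
      refine Finset.sum_congr rfl fun m _ ↦ ?_
      simp only [hH, neg_one_zpow_natCast_add]
      have hpos : (0 : ℝ) < (n : ℝ) + m := by
        have h1 : (1 : ℝ) ≤ n := by exact_mod_cast hs1 n hn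
        have h2 : (0 : ℝ) ≤ m := by positivity
        linarith
      field_simp
    have e2 : ∑ n ∈ s, (π / 2 - Real.arctan (Real.sqrt M₁ / Real.sqrt n)) / 2 * y n ^ 2
        = (1 / 4) * ∑ n ∈ s, 2 * (π / 2 - Real.arctan (Real.sqrt M₁ / Real.sqrt n)) * ((-1 : ℝ) ^ n * y n) ^ 2 := by
      rw [Finset.mul_sum]
      refine Finset.sum_congr rfl fun n _ ↦ ?_
      have hsq : ((-1 : ℝ) ^ n * y n) ^ 2 = y n ^ 2 := by
        rw [mul_pow, ← pow_mul, Nat.mul_comm, pow_mul, neg_one_sq, one_pow, one_mul]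
      rw [hsq]
      ring
    rw [e, e2]
    have := le_abs_self (∑ n ∈ s, ∑ m ∈ s, ((-1 : ℝ) ^ n * y n) * (1 / ((n : ℝ) + m)) * ((-1 : ℝ) ^ m * y m))
    linarith
  -- (iii) remainder
  have hRdiag : ∀ n, R n n = 0 := fun n ↦ by simp [hR]
  have hRoff : ∀ n ∈ s, ∀ m ∈ s, n ≠ m → |R n m| ≤ c / (((min n m : ℕ) : ℝ) * |(n : ℝ) - m|) := by
    intro n hn m hm hnm
    simp only [hR, if_neg hnm, hA, hH]
    exact abs_oddArch_offDiag_add_hilbert_le ha (hs1 n hn) (hs1 m hm) hnm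
  have hHS := sum_sum_sq_le_of_offDiag_bound (N := N) hM R hc0 hRdiag hRoff
  have hRform : |∑ n ∈ s, ∑ m ∈ s, y n * R n m * y m| ≤ c * Real.sqrt (8 / M₁) * ∑ n ∈ s, y n ^ 2 := by
    refine (abs_sum_sum_mul_le_sqrt_mul s R y).trans ?_
    refine mul_le_mul_of_nonneg_right ?_ (Finset.sum_nonneg fun n _ ↦ sq_nonneg _)
    rw [← sqrt_eight_mul_sq_div hc0]
    exact Real.sqrt_le_sqrt hHS
  have hRge : -(c * Real.sqrt (8 / M₁) * ∑ n ∈ s, y n ^ 2) ≤ ∑ n ∈ s, ∑ m ∈ s, y n * R n m * y m := by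
    have := neg_abs_le (∑ n ∈ s, ∑ m ∈ s, y n * R n m * y m); linarith
  -- assemble
  have hlhs : ∑ n ∈ s, ((reDigammaQuarter (freq a n) - Real.log π) / 2 - 1 / (8 * n)
      - a * (1 + E) / (π ^ 2 * n ^ 2) - (π / 2 - Real.arctan (Real.sqrt M₁ / Real.sqrt n)) / 2
      - a * (1 + E) / π ^ 2 * Real.sqrt (8 / M₁)) * y n ^ 2
      = ∑ n ∈ s, ((reDigammaQuarter (freq a n) - Real.log π) / 2 - 1 / (8 * n)
          - a * (1 + E) / (π ^ 2 * n ^ 2)) * y n ^ 2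
        - ∑ n ∈ s, (π / 2 - Real.arctan (Real.sqrt M₁ / Real.sqrt n)) / 2 * y n ^ 2
        - c * Real.sqrt (8 / M₁) * ∑ n ∈ s, y n ^ 2 := by
    rw [Finset.mul_sum, ← Finset.sum_sub_distrib, ← Finset.sum_sub_distrib]
    refine Finset.sum_congr rfl fun n _ ↦ by ring
  rw [hlhs, hform]
  linarith

end Far

end Summit.RiemannHypothesis.RiemannHypothesis.Theorems.WeilFormatC

end
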